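import Mathlib

/-!
# `NewtonUnitEquationsNewtonTauWeakShadowMinkowski` — unique maximisers of a planar Minkowski sum

Registered stub `card_uniqueMax_add_le` of line `binomial-normal-form` (crux `NewtonTauWeak`,
stmt-ValiantsHypothesis-5904), QUASI rung (Minkowski/union subadditivity ⇒ quasi-polynomial hull counts).

Setting.  For a real `σ` and a finite planar set `S ⊂ ℕ²`, `U σ S ⊆ S` is the set of points `s ∈ S` that are
the UNIQUE maximiser over `S` of the linear functional `f_t(s) = t · x(s) + σ · y(s)` for some slope `t ∈ ℝ`
(`x(s) = s 0`, `y(s) = s 1`, cast to `ℝ`); the operator `U` is characterised by the hypothesis `hU`.  The finset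
`(A ×ˢ B).image (fun p => p.1 + p.2)` is the Minkowski sum `A + B`.

Claim (`card_uniqueMax_add_le`): `|U σ (A + B)| ≤ |U σ A| + |U σ B|` (a planar Minkowski sum has at most as
many "upper vertices" as the two summands together).

Proof.
* Decomposition (`ShadowMinkowskiAux.exists_add_of_uniqueMax`): if `p = a + b ∈ A + B` is the unique
  maximiser of `f_t` over `A + B`, then `a` is the unique maximiser of `f_t` over `A` (for `a' ∈ A`, `a' ≠ a`,
  the point `a' + b ∈ A + B` differs from `a + b`, and `f_t` is additive), and likewise `b` over `B`; in
  particular `a ∈ U σ A` and `b ∈ U σ B`.  Choice gives maps `p ↦ τ p, a p, b p` on `P := U σ (A + B)`.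
* Monotonicity (`ShadowMinkowskiAux.apply_zero_lt_of_uniqueMax`): if `a₁ ≠ a₂` are the unique maximisers of
  `f_{t₁}`, `f_{t₂}` over one set and `t₁ ≤ t₂`, then `x(a₁) < x(a₂)` (add the two strict inequalities:
  `(t₂ - t₁) (x(a₂) - x(a₁)) > 0`).
* Ranks: `r_T(u) := #{w ∈ T : x(w) < x(u)}` is monotone in `x(u)`, strictly so from a member of `T`, and is
  `< #T` at members of `T` (`ShadowMinkowskiAux.card_filter_*`).  Hence the rank sum
  `p ↦ r_{U σ A}(a p) + r_{U σ B}(b p)` maps `P` into `range (#(U σ A) + #(U σ B))` and is injective on `P`: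
  for `p ≠ q` in `P` with (wlog) `τ p ≤ τ q`, monotonicity gives `x(a p) ≤ x(a q)` and `x(b p) ≤ x(b q)` with
  at least one of them strict (`(a p, b p) ≠ (a q, b q)` as `p = a p + b p`, `q = a q + b q`), so the rank sum
  strictly increases.  `Finset.card_le_card_of_injOn` and `Finset.card_range` conclude.

Folklore (upper vertices of a planar Minkowski sum); Mathlib only, no named facts, no citations, no `def`s.
-/

-- Sub = Summit single-conjunct layout: the duplicated namespace component is mandated by the tree.
set_option linter.dupNamespace false

noncomputable section

open scoped BigOperators

namespace Summit.ValiantsHypothesis.ValiantsHypothesis.Theorems.NewtonUnitEquationsNewtonTauWeak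

namespace ShadowMinkowskiAux

/-- **Monotonicity of unique maximisers in the slope.**  If `a₁ ≠ a₂` are the unique maximisers over `S` of
`t₁ · x + σ · y` and of `t₂ · x + σ · y` with `t₁ ≤ t₂`, then `x(a₁) < x(a₂)`: adding the two strict
inequalities gives `(t₂ - t₁) (x(a₂) - x(a₁)) > 0`.  (At `t₁ = t₂` this says that the unique maximiser is
unique.) [folklore] -/
theorem apply_zero_lt_of_uniqueMax (σ t₁ t₂ : ℝ) (S : Finset (Fin 2 →₀ ℕ)) (a₁ a₂ : Fin 2 →₀ ℕ)
    (h₁ : a₁ ∈ S) (h₂ : a₂ ∈ S)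
    (hm₁ : ∀ s' ∈ S, s' ≠ a₁ →
      t₁ * ((s' 0 : ℕ) : ℝ) + σ * ((s' 1 : ℕ) : ℝ) < t₁ * ((a₁ 0 : ℕ) : ℝ) + σ * ((a₁ 1 : ℕ) : ℝ))
    (hm₂ : ∀ s' ∈ S, s' ≠ a₂ →
      t₂ * ((s' 0 : ℕ) : ℝ) + σ * ((s' 1 : ℕ) : ℝ) < t₂ * ((a₂ 0 : ℕ) : ℝ) + σ * ((a₂ 1 : ℕ) : ℝ))
    (ht : t₁ ≤ t₂) (hne : a₁ ≠ a₂) : (a₁ 0 : ℕ) < (a₂ 0 : ℕ) := by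
  have e₁ := hm₁ a₂ h₂ hne.symm
  have e₂ := hm₂ a₁ h₁ hne
  have key : ((a₁ 0 : ℕ) : ℝ) < ((a₂ 0 : ℕ) : ℝ) := by
    by_contra h
    push Not at h
    nlinarith [mul_nonneg (sub_nonneg.mpr ht) (sub_nonneg.mpr h)]
  exact_mod_cast key

/-- **Decomposition of a unique maximiser of a Minkowski sum.**  If `p ∈ A + B` is the unique maximiser of
`f_t = t · x + σ · y` over `A + B`, then `p = a + b` with `a ∈ A`, `b ∈ B`, `a` the unique maximiser of `f_t`
over `A` and `b` the unique maximiser of `f_t` over `B`: for `a' ∈ A` with `a' ≠ a` the point `a' + b` lies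
in `A + B` and differs from `a + b`, and `f_t (a' + b) = f_t a' + f_t b`. [folklore] -/
theorem exists_add_of_uniqueMax (σ t : ℝ) (A B : Finset (Fin 2 →₀ ℕ)) (p : Fin 2 →₀ ℕ)
    (hp : p ∈ (A ×ˢ B).image fun q => q.1 + q.2)
    (hm : ∀ s' ∈ (A ×ˢ B).image (fun q => q.1 + q.2), s' ≠ p →
      t * ((s' 0 : ℕ) : ℝ) + σ * ((s' 1 : ℕ) : ℝ) < t * ((p 0 : ℕ) : ℝ) + σ * ((p 1 : ℕ) : ℝ)) :
    ∃ a b : Fin 2 →₀ ℕ, a ∈ A ∧ b ∈ B ∧ p = a + b ∧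
      (∀ a' ∈ A, a' ≠ a →
        t * ((a' 0 : ℕ) : ℝ) + σ * ((a' 1 : ℕ) : ℝ) < t * ((a 0 : ℕ) : ℝ) + σ * ((a 1 : ℕ) : ℝ)) ∧
      (∀ b' ∈ B, b' ≠ b →
        t * ((b' 0 : ℕ) : ℝ) + σ * ((b' 1 : ℕ) : ℝ) < t * ((b 0 : ℕ) : ℝ) + σ * ((b 1 : ℕ) : ℝ)) := by
  simp only [Finset.mem_image, Finset.mem_product, Prod.exists] at hp
  obtain ⟨a, b, ⟨ha, hb⟩, rfl⟩ := hp
  refine ⟨a, b, ha, hb, rfl, fun a' ha' hne => ?_, fun b' hb' hne => ?_⟩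
  · have h := hm (a' + b) (Finset.mem_image.mpr ⟨(a', b), Finset.mk_mem_product ha' hb, rfl⟩)
      fun h => hne (add_right_cancel h)
    simp only [Finsupp.coe_add, Pi.add_apply, Nat.cast_add] at h
    linarith
  · have h := hm (a + b') (Finset.mem_image.mpr ⟨(a, b'), Finset.mk_mem_product ha hb', rfl⟩)
      fun h => hne (add_left_cancel h)
    simp only [Finsupp.coe_add, Pi.add_apply, Nat.cast_add] at h
    linarith

/-- The rank `#{w ∈ T : x(w) < x(u)}` is monotone in `x(u)`. [folklore] -/
theorem card_filter_mono (T : Finset (Fin 2 →₀ ℕ)) (u v : Fin 2 →₀ ℕ) (h : (u 0 : ℕ) ≤ (v 0 : ℕ)) :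
    (T.filter fun w => (w 0 : ℕ) < (u 0 : ℕ)).card ≤ (T.filter fun w => (w 0 : ℕ) < (v 0 : ℕ)).card := by
  refine Finset.card_le_card fun w hw => ?_
  rw [Finset.mem_filter] at hw ⊢
  exact ⟨hw.1, lt_of_lt_of_le hw.2 h⟩

/-- The rank `#{w ∈ T : x(w) < x(u)}` increases strictly from a member `u ∈ T` to any `v` with
`x(u) < x(v)` (`u` itself is newly counted). [folklore] -/
theorem card_filter_strictMono (T : Finset (Fin 2 →₀ ℕ)) (u v : Fin 2 →₀ ℕ) (hu : u ∈ T)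
    (h : (u 0 : ℕ) < (v 0 : ℕ)) :
    (T.filter fun w => (w 0 : ℕ) < (u 0 : ℕ)).card < (T.filter fun w => (w 0 : ℕ) < (v 0 : ℕ)).card := by
  refine Finset.card_lt_card ((Finset.ssubset_iff_of_subset fun w hw => ?_).mpr ⟨u, ?_, fun hu' => ?_⟩)
  · rw [Finset.mem_filter] at hw ⊢
    exact ⟨hw.1, hw.2.trans h⟩
  · exact Finset.mem_filter.mpr ⟨hu, h⟩
  · exact lt_irrefl _ (Finset.mem_filter.mp hu').2

/-- The rank `#{w ∈ T : x(w) < x(u)}` of a member `u ∈ T` is `< #T` (`u` itself is not counted).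
[folklore] -/
theorem card_filter_lt_card (T : Finset (Fin 2 →₀ ℕ)) (u : Fin 2 →₀ ℕ) (hu : u ∈ T) :
    (T.filter fun w => (w 0 : ℕ) < (u 0 : ℕ)).card < T.card := by
  refine Finset.card_lt_card ((Finset.ssubset_iff_of_subset (Finset.filter_subset _ _)).mpr ⟨u, hu, ?_⟩)
  exact fun hu' => lt_irrefl _ (Finset.mem_filter.mp hu').2

end ShadowMinkowskiAux

open ShadowMinkowskiAux in
/-- **Unique-maximiser counts are subadditive under Minkowski sums, registered stub `card_uniqueMax_add_le`
(QUASI rung of line `binomial-normal-form`).**  With `U σ S` the set of points of `S ⊂ ℕ²` that are the unique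
maximiser over `S` of `t · x + σ · y` for some real slope `t` (hypothesis `hU`), and `A + B` the Minkowski sum
`(A ×ˢ B).image (fun p => p.1 + p.2)`: `#U σ (A + B) ≤ #U σ A + #U σ B`.  Proof in the module docstring:
decompose `p = a p + b p` with a common slope `τ p`, and inject `P = U σ (A + B)` into
`range (#U σ A + #U σ B)` by the rank sum `r_{U σ A}(a p) + r_{U σ B}(b p)`, which is strictly monotone
along the slope. [folklore] -/
theorem card_uniqueMax_add_le
    (U : ℝ → Finset (Fin 2 →₀ ℕ) → Finset (Fin 2 →₀ ℕ))
    (hU : ∀ (σ : ℝ) (S : Finset (Fin 2 →₀ ℕ)) (s : Fin 2 →₀ ℕ), s ∈ U σ S ↔ s ∈ S ∧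
      ∃ t : ℝ, ∀ s' ∈ S, s' ≠ s →
        t * ((s' 0 : ℕ) : ℝ) + σ * ((s' 1 : ℕ) : ℝ) < t * ((s 0 : ℕ) : ℝ) + σ * ((s 1 : ℕ) : ℝ))
    (σ : ℝ) (A B : Finset (Fin 2 →₀ ℕ)) :
    (U σ ((A ×ˢ B).image fun p => p.1 + p.2)).card ≤ (U σ A).card + (U σ B).card := by
  -- Step 1: decomposition `p = a + b` with a common slope `t`, `a` / `b` unique maximisers over `A` / `B`.
  have key : ∀ p ∈ U σ ((A ×ˢ B).image fun p => p.1 + p.2), ∃ (t : ℝ) (a b : Fin 2 →₀ ℕ),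
      a ∈ A ∧ b ∈ B ∧ p = a + b ∧
      (∀ a' ∈ A, a' ≠ a →
        t * ((a' 0 : ℕ) : ℝ) + σ * ((a' 1 : ℕ) : ℝ) < t * ((a 0 : ℕ) : ℝ) + σ * ((a 1 : ℕ) : ℝ)) ∧
      (∀ b' ∈ B, b' ≠ b →
        t * ((b' 0 : ℕ) : ℝ) + σ * ((b' 1 : ℕ) : ℝ) < t * ((b 0 : ℕ) : ℝ) + σ * ((b 1 : ℕ) : ℝ)) := by
    intro p hp
    obtain ⟨hpS, t, ht⟩ := (hU σ _ p).mp hp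
    exact ⟨t, exists_add_of_uniqueMax σ t A B p hpS ht⟩
  choose! τ a b ha hb hab hτa hτb using key
  have haU : ∀ p ∈ U σ ((A ×ˢ B).image fun p => p.1 + p.2), a p ∈ U σ A := fun p hp =>
    (hU σ A (a p)).mpr ⟨ha p hp, τ p, hτa p hp⟩
  have hbU : ∀ p ∈ U σ ((A ×ˢ B).image fun p => p.1 + p.2), b p ∈ U σ B := fun p hp =>
    (hU σ B (b p)).mpr ⟨hb p hp, τ p, hτb p hp⟩
  -- Step 2: along the slope the summands move weakly to the right, and at least one of them strictly.
  have hmono : ∀ p ∈ U σ ((A ×ˢ B).image fun p => p.1 + p.2),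
      ∀ q ∈ U σ ((A ×ˢ B).image fun p => p.1 + p.2), τ p ≤ τ q → p ≠ q →
      (a p 0 : ℕ) ≤ (a q 0 : ℕ) ∧ (b p 0 : ℕ) ≤ (b q 0 : ℕ) ∧
        ((a p 0 : ℕ) < (a q 0 : ℕ) ∨ (b p 0 : ℕ) < (b q 0 : ℕ)) := by
    intro p hp q hq hpq hne
    have hA : a p ≠ a q → (a p 0 : ℕ) < (a q 0 : ℕ) :=
      apply_zero_lt_of_uniqueMax σ (τ p) (τ q) A (a p) (a q) (ha p hp) (ha q hq) (hτa p hp) (hτa q hq) hpq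
    have hB : b p ≠ b q → (b p 0 : ℕ) < (b q 0 : ℕ) :=
      apply_zero_lt_of_uniqueMax σ (τ p) (τ q) B (b p) (b q) (hb p hp) (hb q hq) (hτb p hp) (hτb q hq) hpq
    have hAB : a p ≠ a q ∨ b p ≠ b q := by
      by_contra h
      push Not at h
      exact hne (calc p = a p + b p := hab p hp
        _ = a q + b q := by rw [h.1, h.2]
        _ = q := (hab q hq).symm)
    refine ⟨?_, ?_, hAB.imp hA hB⟩
    · by_cases h : a p = a q
      · rw [h]
      · exact (hA h).le
    · by_cases h : b p = b q
      · rw [h]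
      · exact (hB h).le
  -- Step 3: the rank sum is strictly monotone along the slope, hence injective, with values `< #U A + #U B`.
  have hlt : ∀ p ∈ U σ ((A ×ˢ B).image fun p => p.1 + p.2),
      ∀ q ∈ U σ ((A ×ˢ B).image fun p => p.1 + p.2), τ p ≤ τ q → p ≠ q →
      ((U σ A).filter fun w => (w 0 : ℕ) < (a p 0 : ℕ)).card +
          ((U σ B).filter fun w => (w 0 : ℕ) < (b p 0 : ℕ)).card <
        ((U σ A).filter fun w => (w 0 : ℕ) < (a q 0 : ℕ)).card +
          ((U σ B).filter fun w => (w 0 : ℕ) < (b q 0 : ℕ)).card := by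
    intro p hp q hq hpq hne
    obtain ⟨h₁, h₂, h₃ | h₃⟩ := hmono p hp q hq hpq hne
    · exact add_lt_add_of_lt_of_le (card_filter_strictMono _ _ _ (haU p hp) h₃) (card_filter_mono _ _ _ h₂)
    · exact add_lt_add_of_le_of_lt (card_filter_mono _ _ _ h₁) (card_filter_strictMono _ _ _ (hbU p hp) h₃)
  calc (U σ ((A ×ˢ B).image fun p => p.1 + p.2)).card
      ≤ (Finset.range ((U σ A).card + (U σ B).card)).card := by
        refine Finset.card_le_card_of_injOn
          (fun p => ((U σ A).filter fun w => (w 0 : ℕ) < (a p 0 : ℕ)).card +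
            ((U σ B).filter fun w => (w 0 : ℕ) < (b p 0 : ℕ)).card)
          (fun p hp => ?_) (fun p hp q hq h => ?_)
        · have hp' := Finset.mem_coe.mp hp
          exact Finset.mem_coe.mpr (Finset.mem_range.mpr (add_lt_add
            (card_filter_lt_card _ _ (haU p hp')) (card_filter_lt_card _ _ (hbU p hp'))))
        · have hp' := Finset.mem_coe.mp hp
          have hq' := Finset.mem_coe.mp hq
          by_contra hne
          rcases le_total (τ p) (τ q) with hpq | hqp
          · exact absurd h (hlt p hp' q hq' hpq hne).ne
          · exact absurd h (hlt q hq' p hp' hqp (Ne.symm hne)).ne'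
    _ = (U σ A).card + (U σ B).card := Finset.card_range _

end Summit.ValiantsHypothesis.ValiantsHypothesis.Theorems.NewtonUnitEquationsNewtonTauWeak

end
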